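import Summits.KontsevichZagierPeriods.KontsevichZagierPeriods.Theorems.RootDecompZetaThreeFrontierWordMatchPreludeP5

/-! lens-1 g11 MatchPrelude.lean v5 @a732c71a §28 (l.1485–1655): M0-moves on `Δ₃` (rule 1b iterated) and §28b the by-name REDUCTION of the registered stub: `GapClassMatch`, `CongInto`, `gzLETwo` verbatim (skeleton gz_ladder v4 @49ca968c) + `stub_three_match_of_gapClassMatch` — continuation P6 of the census chain …WordMatchPreludeP1–P5. -/

/-! # `RootDecompZetaThreeFrontierWordMatchPreludeP6` — part 1/1 of the mechanical ≤400-line split of `src.lean`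
(split by the decomp-kz census seat for landing; mathematics unchanged). -/

noncomputable section

/-! # §28  M0-MOVES (decomp-kz lens-1 gen 11, fifth addendum): rule 1b iterated on `Δ₃` and the KERNEL-CHECKED REDUCTION of the
registered stub `stub_three_match` to its GAP-CLASS-WISE form `GapClassMatch` (one admissible gap class `q·g^κ/(…)` at a time).
Names carry a `3`/`Three` suffix so that nothing clashes with the rung-2 landing unit `RungTwo.lean` (same namespace). -/

namespace Summit.KontsevichZagierPeriods.RootDecompZetaThreeFrontier.WordLayer

open Set MeasureTheory Literature.NumberTheory.Transcendental
open Summit.KontsevichZagierPeriods.KontsevichZagierPeriods.Theorems.RootDecompZetaThreeFrontierWordMoves (measurableSet_simplex)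

section MovesThree

/-- a representation on `Δ₃` with prescribed integrand -/
def repThree (f : (Fin 3 → ℝ) → ℝ) (hsa : IsSemialgebraicFunOn ℚ (KZ.openOrderedSimplex 3) f)
    (hint : IntegrableOn f (KZ.openOrderedSimplex 3)) : KZ.IntegralRep 3 :=
  ⟨KZ.openOrderedSimplex 3, f, KZ.isSemialgebraic_openOrderedSimplex 3, hsa, hint⟩

/-- Auxiliary step `repThree_domain`. [bookkeeping] -/
@[simp] theorem repThree_domain (f : (Fin 3 → ℝ) → ℝ) (hsa : IsSemialgebraicFunOn ℚ (KZ.openOrderedSimplex 3) f)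
    (hint : IntegrableOn f (KZ.openOrderedSimplex 3)) : (repThree f hsa hint).domain = KZ.openOrderedSimplex 3 := rfl

/-- Auxiliary step `repThree_integrand`. [bookkeeping] -/
@[simp] theorem repThree_integrand (f : (Fin 3 → ℝ) → ℝ) (hsa : IsSemialgebraicFunOn ℚ (KZ.openOrderedSimplex 3) f)
    (hint : IntegrableOn f (KZ.openOrderedSimplex 3)) : (repThree f hsa hint).integrand = f := rfl

/-- a representation whose integrand vanishes on its domain is a relation (rule 1b: `f = f + f`) -/
private theorem of_mem_relations_of_integrand_zero3 {n : ℕ} (z : KZ.IntegralRep n)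
    (hz : ∀ x ∈ z.domain, z.integrand x = 0) : KZ.of z ∈ KZ.relations := by
  have h3 : KZ.of z - KZ.of z - KZ.of z ∈ KZ.relations :=
    KZ.integrandAddRel_subset_relations ⟨n, z, z, z, rfl, rfl, fun x hx => by simp [hz x hx], rfl⟩
  rw [show KZ.of z - KZ.of z - KZ.of z = -KZ.of z by abel] at h3
  exact neg_mem_iff.mp h3

/-- one rule-1b split on `Δ₃` (sum form), for an arbitrary target set `S` of generators -/
theorem of_add_split3 (S : Set KZ.FormalRep) (r r₁ r₂ : KZ.IntegralRep 3) (hd : r.domain = KZ.openOrderedSimplex 3)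
    (hd₁ : r₁.domain = KZ.openOrderedSimplex 3) (hd₂ : r₂.domain = KZ.openOrderedSimplex 3)
    (hsplit : ∀ z ∈ KZ.openOrderedSimplex 3, r.integrand z = r₁.integrand z + r₂.integrand z)
    (h₁ : ∃ m ∈ AddSubgroup.closure S, KZ.of r₁ - m ∈ KZ.relations)
    (h₂ : ∃ m ∈ AddSubgroup.closure S, KZ.of r₂ - m ∈ KZ.relations) :
    ∃ m ∈ AddSubgroup.closure S, KZ.of r - m ∈ KZ.relations := by
  obtain ⟨m₁, hm₁, h₁⟩ := h₁
  obtain ⟨m₂, hm₂, h₂⟩ := h₂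
  have h : KZ.of r - KZ.of r₁ - KZ.of r₂ ∈ KZ.relations :=
    KZ.integrandAddRel_subset_relations ⟨3, r, r₁, r₂, by rw [hd, hd₁], by rw [hd₂, hd], fun z hz => by
      rw [Pi.add_apply]; rw [hd] at hz; exact hsplit z hz, rfl⟩
  refine ⟨m₁ + m₂, add_mem hm₁ hm₂, ?_⟩
  have e : KZ.of r - (m₁ + m₂) = (KZ.of r - KZ.of r₁ - KZ.of r₂) + (KZ.of r₁ - m₁) + (KZ.of r₂ - m₂) := by abel
  rw [e]
  exact add_mem (add_mem h h₁) h₂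

/-- **finite sums on `Δ₃` (rule 1b iterated)**: a finite family of semialgebraic integrable functions on `Δ₃` all of whose
representations are congruent into `closure S` has a semialgebraic integrable sum all of whose representations are congruent into
`closure S`. -/
theorem sum_pack3 (S : Set KZ.FormalRep) {ι : Type*} (T : Finset ι) (f : ι → (Fin 3 → ℝ) → ℝ)
    (hsa : ∀ i ∈ T, IsSemialgebraicFunOn ℚ (KZ.openOrderedSimplex 3) (f i))
    (hint : ∀ i ∈ T, IntegrableOn (f i) (KZ.openOrderedSimplex 3))
    (hmem : ∀ i ∈ T, ∀ (r : KZ.IntegralRep 3), r.domain = KZ.openOrderedSimplex 3 →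
      EqOn r.integrand (f i) r.domain → ∃ m ∈ AddSubgroup.closure S, KZ.of r - m ∈ KZ.relations) :
    IsSemialgebraicFunOn ℚ (KZ.openOrderedSimplex 3) (fun z => ∑ i ∈ T, f i z) ∧
    IntegrableOn (fun z => ∑ i ∈ T, f i z) (KZ.openOrderedSimplex 3) ∧
    ∀ (r : KZ.IntegralRep 3), r.domain = KZ.openOrderedSimplex 3 →
      EqOn r.integrand (fun z => ∑ i ∈ T, f i z) r.domain →
      ∃ m ∈ AddSubgroup.closure S, KZ.of r - m ∈ KZ.relations := by
  classical
  induction T using Finset.induction_on with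
  | empty =>
    refine ⟨(isSemialgebraicFunOn_aeval (KZ.isSemialgebraic_openOrderedSimplex 3) (0 : MvPolynomial (Fin 3) ℚ)).congr
      fun z _ => by simp, by simp, fun r hd hi => ⟨0, zero_mem _, ?_⟩⟩
    rw [sub_zero]
    exact of_mem_relations_of_integrand_zero3 r fun z hz => by rw [hi hz]; simp
  | insert a T haT ih =>
    obtain ⟨hsaT, hintT, hmemT⟩ := ih (fun i hi => hsa i (Finset.mem_insert_of_mem hi))
      (fun i hi => hint i (Finset.mem_insert_of_mem hi)) (fun i hi => hmem i (Finset.mem_insert_of_mem hi))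
    have hsa' : IsSemialgebraicFunOn ℚ (KZ.openOrderedSimplex 3) (fun z => ∑ i ∈ insert a T, f i z) :=
      (IsSemialgebraicFunOn.add_holds (hsa a (Finset.mem_insert_self a T)) hsaT).congr fun z _ => by
        simp only [Pi.add_apply, Finset.sum_insert haT]
    have hint' : IntegrableOn (fun z => ∑ i ∈ insert a T, f i z) (KZ.openOrderedSimplex 3) :=
      ((hint a (Finset.mem_insert_self a T)).add hintT).congr_fun
        (fun z _ => by simp only [Pi.add_apply, Finset.sum_insert haT]) (measurableSet_simplex 3)
    refine ⟨hsa', hint', fun r hd hi => ?_⟩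
    refine of_add_split3 S r (repThree (f a) (hsa a (Finset.mem_insert_self a T)) (hint a (Finset.mem_insert_self a T)))
      (repThree _ hsaT hintT) hd rfl rfl (fun z hz => ?_)
      (hmem a (Finset.mem_insert_self a T) _ rfl fun _ _ => rfl) (hmemT _ rfl fun _ _ => rfl)
    rw [hi (by rw [hd]; exact hz)]
    show ∑ i ∈ insert a T, f i z = f a z + ∑ i ∈ T, f i z
    rw [Finset.sum_insert haT]

/-- the scaled gap class `q · gapF` is `ℚ`-semialgebraic on `Δ₃` -/
theorem gapF_smul_sa (q : ℚ) (κ : Fin 4 → ℕ) (β₀ β₁ γ₁ γ₂ α : ℕ) :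
    IsSemialgebraicFunOn ℚ (KZ.openOrderedSimplex 3) (fun t => (q : ℝ) * gapF κ β₀ β₁ γ₁ γ₂ α t) := by
  refine (isSemialgebraicFunOn_aeval_div_aeval (KZ.isSemialgebraic_openOrderedSimplex 3)
    (MvPolynomial.C q * ((MvPolynomial.C 1 - MvPolynomial.X 0) ^ κ 0 * (MvPolynomial.X 0 - MvPolynomial.X 1) ^ κ 1 *
      (MvPolynomial.X 1 - MvPolynomial.X 2) ^ κ 2 * MvPolynomial.X 2 ^ κ 3))
    (MvPolynomial.X 0 ^ β₀ * MvPolynomial.X 1 ^ β₁ * (MvPolynomial.C 1 - MvPolynomial.X 1) ^ γ₁ *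
      (MvPolynomial.C 1 - MvPolynomial.X 2) ^ γ₂ * (MvPolynomial.X 0 - MvPolynomial.X 2) ^ α) fun t ht => ?_).congr
    fun t ht => ?_
  · simp only [map_mul, map_pow, map_sub, MvPolynomial.aeval_X, map_one]
    exact (layerDen_pos ht β₀ β₁ γ₁ γ₂ α).ne'
  · simp only [map_mul, map_pow, map_sub, MvPolynomial.aeval_X, MvPolynomial.aeval_C, map_one, gapF, eq_ratCast]
    ring

end MovesThree

end Summit.KontsevichZagierPeriods.RootDecompZetaThreeFrontier.WordLayer

/-! ## §28b  THE REDUCTION `GapClassMatch → stub_three_match`, by name in the skeleton namespace -/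

namespace Summit.KontsevichZagierPeriods.KontsevichZagierPeriods.Cruxes.GZNormalFormWThree.GZLadder

open Set MeasureTheory Literature.NumberTheory.Transcendental
open Summit.KontsevichZagierPeriods.RootDecompZetaThreeFrontier

/-- `x` is congruent modulo the KZ moves into the subgroup generated by `S` (verbatim, skeleton `gz_ladder`; ALSO declared by the
rung-2 landing unit `RungTwo.lean` — keep exactly one when landing) -/
def CongInto (S : Set KZ.FormalRep) (x : KZ.FormalRep) : Prop :=
  ∃ m ∈ AddSubgroup.closure S, x - m ∈ KZ.relations

/-- everything genus-zero of dimension `≤ 2`, as formal generators (verbatim, skeleton `gz_ladder`) -/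
def gzLETwo : Set KZ.FormalRep := {x | ∃ (k : ℕ) (s : KZ.IntegralRep k), k ≤ 2 ∧ IsGZ k s ∧ x = KZ.of s}

/-- **GAP-CLASS MATCH** — the gap-class-wise form of `stub_three_match`: ONE admissible scaled gap class
`q·(1-t₀)^κ₀(t₀-t₁)^κ₁(t₁-t₂)^κ₂t₂^κ₃/(t₀^β₀ t₁^β₁ (1-t₁)^γ₁ (1-t₂)^γ₂ (t₀-t₂)^α)` on `Δ₃` (five order conditions) is congruent, modulo the
KZ moves, into the span of the low-pole layer and the genus-zero data of dimension `≤ 2`.  (The IBP steps M2–M4 of the blueprint.) -/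
def GapClassMatch : Prop :=
  ∀ (q : ℚ) (κ : Fin 4 → ℕ) (β₀ β₁ γ₁ γ₂ α : ℕ), β₀ + β₁ + α ≤ κ 1 + κ 2 + κ 3 + 2 → β₁ ≤ κ 2 + κ 3 + 1 →
    α ≤ κ 1 + κ 2 + 1 → γ₁ ≤ κ 0 + κ 1 + 1 → γ₂ + γ₁ + α ≤ κ 0 + κ 1 + κ 2 + 2 →
    ∀ r : KZ.IntegralRep 3, r.domain = simplex 3 →
      EqOn r.integrand (fun t => (q : ℝ) * WordLayer.gapF κ β₀ β₁ γ₁ γ₂ α t) r.domain →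
      CongInto (layerThree ∪ gzLETwo) (KZ.of r)

/-- **the LAYER case of `GapClassMatch`, PROVED**: if the exponents already satisfy the layer bounds, the scaled gap class IS a layer
datum (numerator `q·∏ gapsᵢ^κᵢ ∈ ℚ[t]`), so its class lies in `layerThree` itself. -/
theorem gapClassMatch_layer (q : ℚ) (κ : Fin 4 → ℕ) (β₀ β₁ γ₁ γ₂ α : ℕ) (hα : α ≤ 1) (hβ : β₁ ≤ 1) (hγ : γ₁ ≤ 1)
    (h0 : β₀ + β₁ + α ≤ 2) (h1 : γ₂ + γ₁ + α ≤ 2) (r : KZ.IntegralRep 3) (hd : r.domain = simplex 3)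
    (hi : EqOn r.integrand (fun t => (q : ℝ) * WordLayer.gapF κ β₀ β₁ γ₁ γ₂ α t) r.domain) :
    CongInto (layerThree ∪ gzLETwo) (KZ.of r) := by
  refine ⟨KZ.of r, AddSubgroup.subset_closure (Or.inl ⟨r, ⟨hd, ?_⟩, rfl⟩), by rw [sub_self]; exact zero_mem _⟩
  refine ⟨MvPolynomial.C q * ((MvPolynomial.C 1 - MvPolynomial.X 0) ^ κ 0 * (MvPolynomial.X 0 - MvPolynomial.X 1) ^ κ 1 *
      (MvPolynomial.X 1 - MvPolynomial.X 2) ^ κ 2 * MvPolynomial.X 2 ^ κ 3), β₀, β₁, γ₁, γ₂, α, hα, hβ, hγ, h0, h1, fun t ht => ?_⟩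
  rw [hi ht]
  simp only [map_mul, map_pow, map_sub, MvPolynomial.aeval_X, MvPolynomial.aeval_C, map_one, WordLayer.gapF, eq_ratCast]
  ring

/-- **M0 (moves), PROVED: `GapClassMatch → stub_three_match`.**  Rule 1b iterated over the gap form (§24/§27): an ordered reduced datum is,
on `Δ₃`, the finite sum `Σ_κ coeff_κ(H)·gapF κ`, every summand admissible (hence an honest representation, §26), so its class is congruent into
the target as soon as every scaled admissible gap class is. -/
theorem stub_three_match_of_gapClassMatch (hG : GapClassMatch) :
    ∀ r : KZ.IntegralRep 3, IsReducedOrdThree r → CongInto (layerThree ∪ gzLETwo) (KZ.of r) := by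
  intro r hr
  obtain ⟨β₀, β₁, γ₁, γ₂, α, H, hκ, hd, hi⟩ := integrand_eq_sum_gapF r hr
  have key := (WordLayer.sum_pack3 (layerThree ∪ gzLETwo) H.support
    (fun κ t => ((MvPolynomial.coeff κ H : ℚ) : ℝ) * WordLayer.gapF κ β₀ β₁ γ₁ γ₂ α t)
    (fun κ _ => WordLayer.gapF_smul_sa _ κ β₀ β₁ γ₁ γ₂ α)
    (fun κ hκ' => (WordLayer.gapClass_integrableOn κ (hκ κ hκ').1 (hκ κ hκ').2.1 (hκ κ hκ').2.2.1 (hκ κ hκ').2.2.2.1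
      (hκ κ hκ').2.2.2.2).const_mul _)
    (fun κ hκ' s hs hsi => hG (MvPolynomial.coeff κ H) κ β₀ β₁ γ₁ γ₂ α (hκ κ hκ').1 (hκ κ hκ').2.1 (hκ κ hκ').2.2.1
      (hκ κ hκ').2.2.2.1 (hκ κ hκ').2.2.2.2 s hs hsi)).2.2
  exact key r hd hi

end Summit.KontsevichZagierPeriods.KontsevichZagierPeriods.Cruxes.GZNormalFormWThree.GZLadder

end
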